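/-
Copyright (c) 2026. All rights reserved.
Released under Apache 2.0 license as described in the file LICENSE.
-/
import Mathlib
import HarnessLib
import Literature.Topology.FourManifolds.InteriorManifold
import Literature.Topology.FourManifolds.StableFramesAlongDiscs

/-!
# Tangent calculus on the interior of a manifold with boundary

Topic `Literature/Topology/FourManifolds`. A small supplement to `InteriorManifold.lean` (the
interior `M♭ = M − ∂M` of a manifold with boundary as a boundaryless manifold modelled on the
model vector space `E`) used by the stable-framing computations of the middle-level fact
`Literature.Topology.FourManifolds.exists_middleLevel_isStabilization_of_isHCobordism`, which take
place in the interior `W♭` of a cobordism while the Morse-theoretic objects (levels, Milnor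
boxes, gradient-like fields) live on `W`:

* `InteriorManifold.hasMFDerivAt_val`: the differential of the inclusion `val : M♭ → M` is the
  identity of `E` (in the charts of the interior the inclusion reads as the identity);
  `mfderiv_comp_val`: hence `D(val ∘ F) = DF`.
* `InteriorManifold.trivializationAt_snd_eq`: the tangent-bundle trivializations of `M♭` and of
  `M` agree at interior points (`fderivWithin` on `range I` is `fderiv` there), so a field of
  tangent vectors along a map into `M♭` is continuous into `TM♭` iff it is continuous into `TM`
  (`continuousWithinAt_totalSpaceMk_iff`, `continuousOn_totalSpaceMk_iff`).
* `IsStableFrameFieldOn.pushOn`: push-forward of a stable frame field along a map that is `C¹`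
  with injective differential on an open set containing the image (local form of
  `IsStableFrameFieldOn.push`), and `compMat` of pushed frames.

Everything is proved; no named facts are introduced.

## References

* T. Bröcker, K. Jänich, *Introduction to Differential Topology* (1982), (13.3). [BrockerJanich1982]
-/

noncomputable section

open Set Function Bundle Topology
open scoped Manifold ContDiff Topology

namespace Literature.Topology.FourManifolds

universe u

namespace InteriorManifold

variable {E H : Type*} [NormedAddCommGroup E] [NormedSpace ℝ E] [TopologicalSpace H]
  {I : ModelWithCorners ℝ E H} {M : Type u} [TopologicalSpace M] [ChartedSpace H M] [IsManifold I ∞ M]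

/-! ### The differential of the inclusion -/

omit [IsManifold I ∞ M] in
/-- `range I` is a neighbourhood of the chart image of an interior point. [folklore] -/
theorem range_mem_nhds (x : InteriorManifold I M) : range I ∈ 𝓝 (extChartAt I x.val x.val) :=
  mem_interior_iff_mem_nhds.mp x.property

/-- The target of the extended chart of the interior is a neighbourhood of the chart image.
[folklore] -/
theorem extChartAt_target_mem_nhds' (x : InteriorManifold I M) :
    (extChartAt 𝓘(ℝ, E) x).target ∈ 𝓝 (extChartAt I x.val x.val) := by
  have h := extChartAt_target_mem_nhds (I := 𝓘(ℝ, E)) x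
  rwa [extChartAt_apply] at h

/-- In the extended charts at `x`, the inclusion of the interior reads as the identity near the
chart image of `x`. [folklore] -/
theorem writtenInExtChartAt_val (x : InteriorManifold I M) :
    writtenInExtChartAt 𝓘(ℝ, E) I x (val : InteriorManifold I M → M) =ᶠ[𝓝 (extChartAt I x.val x.val)] id := by
  filter_upwards [extChartAt_target_mem_nhds' x] with y hy
  simp only [writtenInExtChartAt, Function.comp_apply, id_eq]
  rw [extChartAt_symm_apply_val x hy]
  refine (extChartAt I x.val).right_inv ?_
  rw [extChartAt_target] at hy
  rw [_root_.extChartAt_target]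
  exact ⟨hy.1, interior_subset hy.2⟩

/-- **The differential of the inclusion of the interior is the identity** (the tangent spaces
of `M♭` at `x` and of `M` at `x.val` are both the model vector space `E`). [folklore] -/
theorem hasMFDerivAt_val (x : InteriorManifold I M) :
    HasMFDerivAt 𝓘(ℝ, E) I (val : InteriorManifold I M → M) x (ContinuousLinearMap.id ℝ E) := by
  refine ⟨contMDiff_val.continuous.continuousAt, ?_⟩
  have h : HasFDerivAt (writtenInExtChartAt 𝓘(ℝ, E) I x (val : InteriorManifold I M → M))
      (ContinuousLinearMap.id ℝ E) (extChartAt 𝓘(ℝ, E) x x) := by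
    rw [extChartAt_apply]
    exact (hasFDerivAt_id _).congr_of_eventuallyEq (writtenInExtChartAt_val x)
  exact h.hasFDerivWithinAt

/-- The inclusion is differentiable. [folklore] -/
theorem mdifferentiableAt_val (x : InteriorManifold I M) :
    MDifferentiableAt 𝓘(ℝ, E) I (val : InteriorManifold I M → M) x :=
  (hasMFDerivAt_val x).mdifferentiableAt

/-- `D val = id`. [folklore] -/
theorem mfderiv_val (x : InteriorManifold I M) :
    mfderiv 𝓘(ℝ, E) I (val : InteriorManifold I M → M) x = ContinuousLinearMap.id ℝ E :=
  (hasMFDerivAt_val x).mfderiv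

variable {F' H' : Type*} [NormedAddCommGroup F'] [NormedSpace ℝ F'] [TopologicalSpace H']
  {J : ModelWithCorners ℝ F' H'} {N : Type*} [TopologicalSpace N] [ChartedSpace H' N]

/-- **`D(val ∘ F) = DF`** for a differentiable map into the interior. [folklore] -/
theorem mfderiv_comp_val {F : N → InteriorManifold I M} {x : N} (hF : MDifferentiableAt J 𝓘(ℝ, E) F x) :
    mfderiv J I (val ∘ F) x = mfderiv J 𝓘(ℝ, E) F x := by
  rw [((hasMFDerivAt_val (F x)).comp x hF.hasMFDerivAt).mfderiv]
  ext v
  rfl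

/-- Pointwise form of `mfderiv_comp_val`. [folklore] -/
theorem mfderiv_comp_val_apply {F : N → InteriorManifold I M} {x : N} (hF : MDifferentiableAt J 𝓘(ℝ, E) F x)
    (v : TangentSpace J x) : mfderiv J I (val ∘ F) x v = mfderiv J 𝓘(ℝ, E) F x v :=
  congrArg (fun T : TangentSpace J x →L[ℝ] E => T v) (mfderiv_comp_val hF)

/-! ### Tangent vectors along maps into the interior -/

/-- **The tangent-bundle trivializations of the interior are those of `M`** at interior points:
the coordinate change `D(φ̂_{x₀} ∘ φ̂_p⁻¹)` is computed with `fderiv` for `M♭` and with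
`fderivWithin (range I)` for `M`, and these agree at points of the interior of `range I`.
[folklore] -/
theorem trivializationAt_snd_eq (x₀ : InteriorManifold I M) (z : TangentBundle 𝓘(ℝ, E) (InteriorManifold I M)) :
    (trivializationAt E (TangentSpace 𝓘(ℝ, E)) x₀ z).2 =
      (trivializationAt E (TangentSpace I) x₀.val (⟨z.proj.val, z.2⟩ : TangentBundle I M)).2 := by
  rw [TangentBundle.trivializationAt_apply, TangentBundle.trivializationAt_apply]
  change fderivWithin ℝ (extChartAt 𝓘(ℝ, E) x₀ ∘ (extChartAt 𝓘(ℝ, E) z.proj).symm) (range (𝓘(ℝ, E)))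
      (extChartAt 𝓘(ℝ, E) z.proj z.proj) z.2 =
    fderivWithin ℝ (extChartAt I x₀.val ∘ (extChartAt I z.proj.val).symm) (range I)
      (extChartAt I z.proj.val z.proj.val) z.2
  rw [modelWithCornersSelf_coe, range_id, fderivWithin_univ, extChartAt_apply,
    fderivWithin_of_mem_nhds (range_mem_nhds z.proj)]
  congr 1
  apply Filter.EventuallyEq.fderiv_eq
  filter_upwards [extChartAt_target_mem_nhds' z.proj] with y hy
  simp only [Function.comp_apply]
  rw [extChartAt_apply, extChartAt_symm_apply_val z.proj hy]

variable {X : Type*} [TopologicalSpace X]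

/-- **A field of tangent vectors along a map into the interior is continuous into `TM♭` iff the
map is continuous and the field is continuous into `TM`** (within a set, at a point). [folklore] -/
theorem continuousWithinAt_totalSpaceMk_iff {g : X → InteriorManifold I M} {v : X → E} {s : Set X} {q₀ : X} :
    ContinuousWithinAt (fun q => (TotalSpace.mk' E (g q) (v q) : TangentBundle 𝓘(ℝ, E) (InteriorManifold I M))) s q₀ ↔
      ContinuousWithinAt g s q₀ ∧
        ContinuousWithinAt (fun q => (TotalSpace.mk' E (g q).val (v q) : TangentBundle I M)) s q₀ := by
  rw [FiberBundle.continuousWithinAt_totalSpace, FiberBundle.continuousWithinAt_totalSpace]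
  have hfun : (fun q => (trivializationAt E (TangentSpace 𝓘(ℝ, E)) (g q₀)
      (TotalSpace.mk' E (g q) (v q) : TangentBundle 𝓘(ℝ, E) (InteriorManifold I M))).2) =
      fun q => (trivializationAt E (TangentSpace I) (g q₀).val (TotalSpace.mk' E (g q).val (v q) : TangentBundle I M)).2 := by
    funext q
    exact trivializationAt_snd_eq (g q₀) _
  constructor
  · rintro ⟨h1, h2⟩
    refine ⟨h1, contMDiff_val.continuous.continuousAt.comp_continuousWithinAt h1, ?_⟩
    change ContinuousWithinAt (fun q => (trivializationAt E (TangentSpace I) (g q₀).val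
      (TotalSpace.mk' E (g q).val (v q) : TangentBundle I M)).2) s q₀
    rw [← hfun]; exact h2
  · rintro ⟨h1, -, h2⟩
    refine ⟨h1, ?_⟩
    change ContinuousWithinAt (fun q => (trivializationAt E (TangentSpace 𝓘(ℝ, E)) (g q₀)
      (TotalSpace.mk' E (g q) (v q) : TangentBundle 𝓘(ℝ, E) (InteriorManifold I M))).2) s q₀
    rw [hfun]; exact h2

/-- **Set version**: a field of tangent vectors along a continuous map into the interior is
continuous into `TM♭` on a set iff it is continuous into `TM` there. [folklore] -/
theorem continuousOn_totalSpaceMk_iff {g : X → InteriorManifold I M} {v : X → E} {s : Set X} (hg : ContinuousOn g s) :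
    ContinuousOn (fun q => (TotalSpace.mk' E (g q) (v q) : TangentBundle 𝓘(ℝ, E) (InteriorManifold I M))) s ↔
      ContinuousOn (fun q => (TotalSpace.mk' E (g q).val (v q) : TangentBundle I M)) s :=
  ⟨fun h q hq => ((continuousWithinAt_totalSpaceMk_iff.mp (h q hq)).2),
    fun h q hq => continuousWithinAt_totalSpaceMk_iff.mpr ⟨hg q hq, h q hq⟩⟩

end InteriorManifold

/-! ### Local push-forward of stable frame fields -/

namespace StableFrames

/-- Local notation: `𝔼 n` is the model Euclidean space `EuclideanSpace ℝ (Fin n)`. -/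
local notation "𝔼 " n:arg => EuclideanSpace ℝ (Fin n)

variable {m : ℕ} {M : Type*} [TopologicalSpace M] [ChartedSpace (𝔼 m) M] [IsManifold (𝓡 m) 1 M]
  {M' : Type*} [TopologicalSpace M'] [ChartedSpace (𝔼 m) M'] [IsManifold (𝓡 m) 1 M']
  {X : Type*} [TopologicalSpace X]

/-- **Local push-forward**: a stable frame field along `G` pushed along a map `φ` that is `C¹`
with injective differential on an open set `U` containing `G(R)` is a stable frame field along
`φ ∘ G`. [folklore] -/
theorem _root_.Literature.Topology.FourManifolds.IsStableFrameFieldOn.pushOn {φ : M → M'} {U : Set M} (hU : IsOpen U)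
    (hφ : ContMDiffOn (𝓡 m) (𝓡 m) 1 φ U) (hinj : ∀ x ∈ U, Injective (mfderiv (𝓡 m) (𝓡 m) φ x))
    {G : X → M} {F : X → Fr m} {R : Set X} (h : IsStableFrameFieldOn G F R) (hGU : MapsTo G R U) :
    IsStableFrameFieldOn (φ ∘ G) (fun q => pushFr φ (G q) (F q)) R := by
  refine ⟨fun i => ?_, fun i => h.2.1 i, fun q hq => ?_⟩
  · exact ContinuousOn.totalSpaceMk_mfderiv (g := G) hU hφ (h.1 i) hGU
  · change LinearIndependent ℝ (pushFr φ (G q) (F q))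
    rw [pushFr_eq]
    exact (h.2.2 q hq).map' _ (LinearMap.ker_eq_bot.mpr (injective_pushLin (hinj (G q) (hGU hq))))

/-- **Constant frames of a vector space are stable frame fields** along any continuous map into
it (the tangent bundle of the model space is trivial). [folklore] -/
theorem isStableFrameFieldOn_const {g : X → 𝔼 m} (hg : Continuous g) {A : Fr m} (hA : LinearIndependent ℝ A) (R : Set X) :
    IsStableFrameFieldOn g (fun _ => A) R := by
  refine ⟨fun i => ?_, fun i => continuousOn_const, fun q _ => hA⟩
  exact ((tangentBundleModelSpaceHomeomorph (𝓡 m)).symm.continuous.comp (hg.prodMk continuous_const)).continuousOn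

/-- **Continuous frames of a vector space are stable frame fields** along any continuous map
into it. [folklore] -/
theorem isStableFrameFieldOn_self {g : X → 𝔼 m} (hg : Continuous g) {A : X → Fr m} (hA : ∀ i, Continuous fun q => A q i)
    (hli : ∀ q, LinearIndependent ℝ (A q)) (R : Set X) : IsStableFrameFieldOn g A R := by
  refine ⟨fun i => ?_, fun i => (continuous_snd.comp (hA i)).continuousOn, fun q _ => hli q⟩
  exact ((tangentBundleModelSpaceHomeomorph (𝓡 m)).symm.continuous.comp
    (hg.prodMk (continuous_fst.comp (hA i)))).continuousOn

end StableFrames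

end Literature.Topology.FourManifolds
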